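import Summits.CriticalPhenomena.PercolationContinuityZ3.Theorems.SahiAEBorelVersionPosTransport
import Summits.CriticalPhenomena.PercolationContinuityZ3.Theorems.SahiAEVersionTransportAtoms
import Summits.CriticalPhenomena.PercolationContinuityZ3.Theorems.SahiAEBorelVersionPi

/-!
# Uniformly positive Borel everywhere-MTP₂ versions under every product σ-finite reference measure (atoms allowed); the additive form

Support file of the Sahi cell (`prim-sahi`, typer seat, generation 22; `--supports stmt-CriticalPhenomena-4575`).
Theorems only (no definitions, no named facts, no sorries).

Completion of the two-sided transport started in `SahiAEBorelVersionPosTransport.lean`: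

* `HasPosBorelMTP2Versions.pi_of_restrict_openUnitCube'` — Lebesgue on the open cube ⟹ every finite product of
  probability measures on `ℝ`, ATOMS ALLOWED, by a **fixed section of the randomised probability integral
  transform**: for a cube version `F'` (positive and MTP₂ at every pair of `ℝ^ι`) put `F(x) := F'(θ_x(v₀))`,
  `θ_x(v) = (Φᵢ(xᵢ−) + vᵢ (Φᵢ(xᵢ) − Φᵢ(xᵢ−)))ᵢ`, for ONE randomisation `v₀ ∈ (0,1)^ι`.  Since `x ↦ θ_x(v₀)` is
  coordinatewise monotone at every point (`rpit_le_rpit_of_lt`), `F` is MTP₂ at every pair and inherits the bounds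
  of `F'`; and by Fubini (`Measure.ae_ae_comm` applied to `F'(θ_{Q u}(v)) = f(Q u)` for a.e. `(u, v)`,
  `quasiMeasurePreserving_rpit_rqe`) almost every `v₀` makes `F` a version of `f`.  This is a second, `ess sup`-free
  proof of the descent of `SahiAEVersionTransportAtoms` (where `F(x) = ess sup_v F'(θ_x(v))`).
* `HasPosBorelMTP2Versions.pi_of_volume'`, `hasPosBorelMTP2Versions_pi` — **every finite product of σ-finite
  measures on `ℝ` has the two-sided Borel-version property**; `exists_pos_measurable_mtp2_version_of_ae_pi` —
  unfolded: a measurable `f : ℝ^ι → [c, M]` (`0 < c`, `M < ∞`) MTP₂ on `(⊗ρᵢ) ⊗ (⊗ρᵢ)`-a.e. pair has a Borel version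
  `F = f` a.e., `0 < c' ≤ F ≤ M' < ∞`, `F(x) F(y) ≤ F(x ∧ y) F(x ∨ y)` for ALL `x, y` (answers the referee's R310
  caveat "bounded above, not below" for every product reference measure); `…_pi'` — the same with the bounds
  `c ≤ f ≤ M` assumed only almost everywhere.
* **The additive form** `HasPosBorelMTP2Versions.exists_supermodular_version`,
  `exists_measurable_supermodular_version_of_ae_pi`: a bounded measurable `φ : ℝ^ι → ℝ` supermodular on
  `(⊗ρᵢ) ⊗ (⊗ρᵢ)`-almost every pair has a bounded Borel version supermodular at EVERY pair (`ψ = log F`).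

Scope: densities with zeros / not bounded away from `0` and `∞`, non-product reference measures, infinite products —
not treated (see `SahiAEBorelVersionPi.lean`).  No sorries, no new axioms.
-/

noncomputable section

namespace Summit.CriticalPhenomena.PercolationContinuityZ3.Theorems.SahiAEFourFunctions

open MeasureTheory Set Filter Topology ProbabilityTheory RealQuantile Function
open scoped ENNReal NNReal

variable {ι : Type*} [Fintype ι]

/-! ### Atoms: a fixed section of the randomised probability integral transform -/

section Atoms

omit [Fintype ι] in
/-- For a fixed randomisation `v ∈ [0,1]`, `t ↦ rpit μ t v` is monotone. [folklore] -/
theorem rpit_mono_left (μ : Measure ℝ) {v : ℝ} (hv : v ∈ Icc (0 : ℝ) 1) : Monotone fun t => rpit μ t v := by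
  intro s t hst
  rcases hst.eq_or_lt with h | h
  · rw [h]
  · exact rpit_le_rpit_of_lt μ h hv hv

/-- **Lebesgue on the open unit cube ⟹ every finite product of probability measures on `ℝ` (atoms allowed),
two-sided form**, by a fixed section of the randomised probability integral transform chosen by Fubini. [this work] -/
theorem HasPosBorelMTP2Versions.pi_of_restrict_openUnitCube'
    (hP : HasPosBorelMTP2Versions ((volume : Measure (ι → ℝ)).restrict (Set.pi univ fun _ => Ioo (0 : ℝ) 1)))
    (ν : ι → Measure ℝ) [∀ i, IsProbabilityMeasure (ν i)] : HasPosBorelMTP2Versions (Measure.pi ν) := by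
  classical
  intro f hf c M hc hM hcf hfM hMTP
  set U : Set (ι → ℝ) := Set.pi univ fun _ => Ioo (0 : ℝ) 1 with hU
  have mU : MeasurableSet U := MeasurableSet.univ_pi fun _ => measurableSet_Ioo
  set μ₁ : Measure (ι → ℝ) := (volume : Measure (ι → ℝ)).restrict U with hμ₁
  have hμ₁pi : μ₁ = Measure.pi fun _ : ι => (volume : Measure ℝ).restrict (Ioo (0 : ℝ) 1) := by
    rw [hμ₁, hU, volume_pi, Measure.restrict_pi_pi]
  have hμ₁0 : μ₁ ≠ 0 := by
    intro h
    have h1 : μ₁ U = 0 := by rw [h]; rfl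
    rw [hμ₁, Measure.restrict_apply_self, hU, volume_pi_pi] at h1
    simp only [Real.volume_Ioo, sub_zero, ENNReal.ofReal_one, Finset.prod_const_one, one_ne_zero] at h1
  haveI : IsFiniteMeasure μ₁ := by
    refine ⟨?_⟩
    rw [hμ₁, Measure.restrict_apply_univ, hU, volume_pi_pi]
    simp only [Real.volume_Ioo, sub_zero, ENNReal.ofReal_one, Finset.prod_const_one, ENNReal.one_lt_top]
  -- the quantile map and the pulled-back density
  set T : (ι → ℝ) → (ι → ℝ) := fun u i => rqe (ν i) (u i) with hT
  have hTmp : MeasurePreserving T μ₁ (Measure.pi ν) := by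
    rw [hμ₁pi]; exact measurePreserving_pi _ _ fun i => measurePreserving_rqe (ν i)
  have haeU : ∀ᵐ u ∂μ₁, u ∈ U := ae_restrict_mem mU
  have haeU2 : ∀ᵐ p ∂μ₁.prod μ₁, p.1 ∈ U ∧ p.2 ∈ U := by
    filter_upwards [(Measure.quasiMeasurePreserving_fst (μ := μ₁) (ν := μ₁)).ae haeU,
      (Measure.quasiMeasurePreserving_snd (μ := μ₁) (ν := μ₁)).ae haeU] with p h1 h2 using ⟨h1, h2⟩
  have hTlat : ∀ᵐ p ∂μ₁.prod μ₁, T (p.1 ⊓ p.2) = T p.1 ⊓ T p.2 ∧ T (p.1 ⊔ p.2) = T p.1 ⊔ T p.2 := by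
    filter_upwards [haeU2] with p hp
    refine ⟨funext fun i => ?_, funext fun i => ?_⟩
    · exact (monotoneOn_rqe (ν i)).map_inf (Set.mem_univ_pi.1 hp.1 i) (Set.mem_univ_pi.1 hp.2 i)
    · exact (monotoneOn_rqe (ν i)).map_sup (Set.mem_univ_pi.1 hp.1 i) (Set.mem_univ_pi.1 hp.2 i)
  have hqmp2 : Measure.QuasiMeasurePreserving (Prod.map T T) (μ₁.prod μ₁) ((Measure.pi ν).prod (Measure.pi ν)) :=
    MeasureTheory.QuasiMeasurePreserving.prodMap hTmp.quasiMeasurePreserving hTmp.quasiMeasurePreserving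
  have hMTP' : ∀ᵐ p ∂μ₁.prod μ₁, f (T p.1) * f (T p.2) ≤ f (T (p.1 ⊓ p.2)) * f (T (p.1 ⊔ p.2)) := by
    filter_upwards [hqmp2.ae hMTP, hTlat] with p hp hl
    rw [hl.1, hl.2]; exact hp
  obtain ⟨F', hF'm, ⟨c', M', hc', hM', hF'b⟩, hF'ae, hF'mtp⟩ :=
    hP (f ∘ T) (hf.comp hTmp.measurable) c M hc hM (fun x => hcf (T x)) (fun x => hfM (T x)) hMTP'
  -- the transform
  set θ : (ι → ℝ) → (ι → ℝ) → (ι → ℝ) := fun x v i => rpit (ν i) (x i) (v i) with hθ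
  have hθm : Measurable fun q : (ι → ℝ) × (ι → ℝ) => θ q.1 q.2 := by
    refine measurable_pi_iff.2 fun i => ?_
    have hq : Measurable fun q : (ι → ℝ) × (ι → ℝ) => ((q.1 i, q.2 i) : ℝ × ℝ) :=
      ((measurable_pi_apply i).comp measurable_fst).prodMk ((measurable_pi_apply i).comp measurable_snd)
    show Measurable fun q : (ι → ℝ) × (ι → ℝ) => rpit (ν i) (q.1 i) (q.2 i)
    exact (measurable_rpit (ν i)).comp hq
  -- Fubini: for a.e. randomisation `v`, `u ↦ F'(θ_{Q u}(v))` is a version of `f ∘ Q`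
  set κ : (ι → ℝ) × (ι → ℝ) → (ι → ℝ) := fun q => θ (T q.1) q.2 with hκ
  have hκqmp : Measure.QuasiMeasurePreserving κ (μ₁.prod μ₁) μ₁ := by
    have he := (measurePreserving_arrowProdEquivProdArrow ℝ ℝ ι
      (fun _ : ι => (volume : Measure ℝ).restrict (Ioo (0 : ℝ) 1))
      (fun _ : ι => (volume : Measure ℝ).restrict (Ioo (0 : ℝ) 1))).symm
    rw [← hμ₁pi] at he
    have hK : Measure.QuasiMeasurePreserving
        (fun (w : ι → ℝ × ℝ) i => rpit (ν i) (rqe (ν i) (w i).1) (w i).2)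
        (Measure.pi fun _ : ι => ((volume : Measure ℝ).restrict (Ioo (0 : ℝ) 1)).prod
          ((volume : Measure ℝ).restrict (Ioo (0 : ℝ) 1))) μ₁ := by
      rw [hμ₁pi]
      exact quasiMeasurePreserving_pi_map
        (k := fun i (z : ℝ × ℝ) => rpit (ν i) (rqe (ν i) z.1) z.2)
        fun i => quasiMeasurePreserving_rpit_rqe (ν i)
    have hcomp : κ = (fun (w : ι → ℝ × ℝ) i => rpit (ν i) (rqe (ν i) (w i).1) (w i).2) ∘
        (MeasurableEquiv.arrowProdEquivProdArrow ℝ ℝ ι).symm := by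
      funext q; rfl
    rw [hcomp]
    exact hK.comp he.quasiMeasurePreserving
  have h1 : ∀ᵐ q ∂μ₁.prod μ₁, F' (κ q) = f (T (κ q)) := hκqmp.ae hF'ae
  have h2 : ∀ᵐ q ∂μ₁.prod μ₁, T (κ q) = T q.1 := by
    filter_upwards [haeU2] with q hq
    funext i
    have hu := Set.mem_univ_pi.1 hq.1 i
    have hv := Set.mem_univ_pi.1 hq.2 i
    have h := rq_rpit_rq (ν i) hu hv
    show rqe (ν i) (rpit (ν i) (rqe (ν i) (q.1 i)) (q.2 i)) = rqe (ν i) (q.1 i)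
    rw [rqe_of_mem _ hu, rqe_of_mem _ h.1, h.2]
  have h3' : ∀ᵐ q ∂μ₁.prod μ₁, F' (θ (T q.1) q.2) = f (T q.1) := by
    filter_upwards [h1, h2] with q hq1 hq2
    rw [hq2] at hq1; exact hq1
  have h3 : ∀ᵐ u ∂μ₁, ∀ᵐ v ∂μ₁, F' (θ (T u) v) = f (T u) :=
    Measure.ae_ae_of_ae_prod (p := fun q : (ι → ℝ) × (ι → ℝ) => F' (θ (T q.1) q.2) = f (T q.1)) h3'
  have hPm : MeasurableSet {q : (ι → ℝ) × (ι → ℝ) | F' (θ (T q.1) q.2) = f (T q.1)} :=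
    measurableSet_eq_fun (hF'm.comp (hθm.comp ((hTmp.measurable.comp measurable_fst).prodMk measurable_snd)))
      (hf.comp (hTmp.measurable.comp measurable_fst))
  have h3s : ∀ᵐ v ∂μ₁, ∀ᵐ u ∂μ₁, F' (θ (T u) v) = f (T u) :=
    (Measure.ae_ae_comm (μ := μ₁) (ν := μ₁) (p := fun u v => F' (θ (T u) v) = f (T u)) hPm).1 h3
  -- a good randomisation `v₀`
  haveI : (ae μ₁).NeBot := ae_neBot.2 hμ₁0
  obtain ⟨v₀, hv₀U, hv₀⟩ := (haeU.and h3s).exists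
  have hv₀' : ∀ i, v₀ i ∈ Icc (0 : ℝ) 1 := fun i => Ioo_subset_Icc_self (Set.mem_univ_pi.1 hv₀U i)
  -- the section `x ↦ θ_x(v₀)` is a lattice homomorphism at every pair
  have hθlat : ∀ x y, θ (x ⊓ y) v₀ = θ x v₀ ⊓ θ y v₀ ∧ θ (x ⊔ y) v₀ = θ x v₀ ⊔ θ y v₀ := fun x y =>
    ⟨funext fun i => (rpit_mono_left (ν i) (hv₀' i)).map_inf (x i) (y i),
      funext fun i => (rpit_mono_left (ν i) (hv₀' i)).map_sup (x i) (y i)⟩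
  have hθm' : Measurable fun x => θ x v₀ := hθm.comp (measurable_id.prodMk measurable_const)
  refine ⟨fun x => F' (θ x v₀), hF'm.comp hθm', ⟨c', M', hc', hM', fun x => hF'b _⟩, ?_, fun x y => ?_⟩
  · -- a version: `F' (θ (T u) v₀) = f (T u)` for a.e. `u`, and `T_* μ₁ = ⊗ νᵢ`
    rw [← hTmp.map_eq]
    exact (ae_map_iff hTmp.measurable.aemeasurable (measurableSet_eq_fun (hF'm.comp hθm') hf)).2 hv₀
  · show F' (θ x v₀) * F' (θ y v₀) ≤ F' (θ (x ⊓ y) v₀) * F' (θ (x ⊔ y) v₀)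
    rw [(hθlat x y).1, (hθlat x y).2]
    exact hF'mtp _ _

end Atoms

/-! ### Products of σ-finite measures -/

section SigmaFinite

/-- **Lebesgue on `ℝ^ι` ⟹ every finite product of σ-finite measures on `ℝ` (atoms allowed), two-sided form.**
[this work] -/
theorem HasPosBorelMTP2Versions.pi_of_volume' (hP : HasPosBorelMTP2Versions (volume : Measure (ι → ℝ)))
    (ρ : ι → Measure ℝ) [∀ i, SigmaFinite (ρ i)] : HasPosBorelMTP2Versions (Measure.pi ρ) := by
  by_cases h0 : ∃ i, ρ i = 0
  · obtain ⟨i, hi⟩ := h0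
    have hpi : Measure.pi ρ = 0 := by
      rw [← Measure.measure_univ_eq_zero, Measure.pi_univ]
      exact Finset.prod_eq_zero (Finset.mem_univ i) (by rw [hi]; rfl)
    rw [hpi]
    exact hasPosBorelMTP2Versions_zero
  · push Not at h0
    haveI : ∀ i, NeZero (ρ i) := fun i => ⟨h0 i⟩
    set ν : ι → Measure ℝ := fun i => (ρ i).toFinite with hν
    haveI : ∀ i, IsProbabilityMeasure (ν i) := fun i => by rw [hν]; infer_instance
    have hPν : HasPosBorelMTP2Versions (Measure.pi ν) :=
      (hP.restrict_openUnitCube).pi_of_restrict_openUnitCube' ν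
    exact hPν.of_equivalent (pi_absolutelyContinuous_pi_toFinite ρ) (pi_toFinite_absolutelyContinuous_pi ρ)

/-- **Every finite product of σ-finite measures on `ℝ` has the two-sided Borel-version property** (atoms allowed).
[this work] -/
theorem hasPosBorelMTP2Versions_pi (ρ : ι → Measure ℝ) [∀ i, SigmaFinite (ρ i)] :
    HasPosBorelMTP2Versions (Measure.pi ρ) :=
  hasPosBorelMTP2Versions_volume.pi_of_volume' ρ

/-- Lebesgue measure restricted to ANY product set `∏ᵢ sᵢ ⊆ ℝ^ι` has the two-sided property. [this work] -/
theorem hasPosBorelMTP2Versions_volume_restrict_pi (s : ι → Set ℝ) :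
    HasPosBorelMTP2Versions ((volume : Measure (ι → ℝ)).restrict (Set.pi univ s)) := by
  rw [volume_pi, Measure.restrict_pi_pi]
  exact hasPosBorelMTP2Versions_pi fun i => (volume : Measure ℝ).restrict (s i)

/-- **Unfolded form.**  For every finite family of σ-finite measures `ρᵢ` on `ℝ` (atoms allowed), every measurable
`f : ℝ^ι → [c, M]` (`0 < c`, `M < ∞`) which is MTP₂ on `(⊗ρᵢ) ⊗ (⊗ρᵢ)`-almost every pair has a measurable version
`F = f` a.e. with TWO-SIDED bounds `0 < c' ≤ F ≤ M' < ∞` and `F(x) F(y) ≤ F(x ∧ y) F(x ∨ y)` for ALL `x, y`.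
[this work] -/
theorem exists_pos_measurable_mtp2_version_of_ae_pi (ρ : ι → Measure ℝ) [∀ i, SigmaFinite (ρ i)]
    (f : (ι → ℝ) → ℝ≥0∞) (hf : Measurable f) {c M : ℝ≥0∞} (hc : c ≠ 0) (hM : M ≠ ∞)
    (hcf : ∀ x, c ≤ f x) (hfM : ∀ x, f x ≤ M)
    (hMTP : ∀ᵐ p ∂(Measure.pi ρ).prod (Measure.pi ρ), f p.1 * f p.2 ≤ f (p.1 ⊓ p.2) * f (p.1 ⊔ p.2)) :
    ∃ F : (ι → ℝ) → ℝ≥0∞, Measurable F ∧ (∃ c' M' : ℝ≥0∞, c' ≠ 0 ∧ M' ≠ ∞ ∧ ∀ x, c' ≤ F x ∧ F x ≤ M') ∧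
      F =ᵐ[Measure.pi ρ] f ∧ ∀ x y, F x * F y ≤ F (x ⊓ y) * F (x ⊔ y) :=
  hasPosBorelMTP2Versions_pi ρ f hf c M hc hM hcf hfM hMTP

/-- **The same with almost-everywhere bounds** `c ≤ f ≤ M` (modify `f` on the exceptional null set first; the
a.e.-MTP₂ hypothesis survives by quasi-invariance of `π ⊗ π` under `∧`, `∨`, `ae_prod_mem_inf_sup_of_sigmaFinite`).
[this work] -/
theorem exists_pos_measurable_mtp2_version_of_ae_pi' (ρ : ι → Measure ℝ) [∀ i, SigmaFinite (ρ i)]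
    (f : (ι → ℝ) → ℝ≥0∞) (hf : Measurable f) {c M : ℝ≥0∞} (hc : c ≠ 0) (hM : M ≠ ∞)
    (hbd : ∀ᵐ x ∂Measure.pi ρ, c ≤ f x ∧ f x ≤ M)
    (hMTP : ∀ᵐ p ∂(Measure.pi ρ).prod (Measure.pi ρ), f p.1 * f p.2 ≤ f (p.1 ⊓ p.2) * f (p.1 ⊔ p.2)) :
    ∃ F : (ι → ℝ) → ℝ≥0∞, Measurable F ∧ (∃ c' M' : ℝ≥0∞, c' ≠ 0 ∧ M' ≠ ∞ ∧ ∀ x, c' ≤ F x ∧ F x ≤ M') ∧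
      F =ᵐ[Measure.pi ρ] f ∧ ∀ x y, F x * F y ≤ F (x ⊓ y) * F (x ⊔ y) := by
  set π := Measure.pi ρ with hπ
  by_cases hcM : c ≤ M
  swap
  · -- then the bounds force `π = 0`, and the constant `1` is a version
    have h0 : ∀ᵐ x ∂π, False := by
      filter_upwards [hbd] with x hx using hcM (hx.1.trans hx.2)
    have hπ0 : π = 0 := ae_eq_bot.1 (Filter.eventually_false_iff_eq_bot.1 h0)
    refine ⟨fun _ => 1, measurable_const, ⟨1, 1, one_ne_zero, ENNReal.one_ne_top, fun _ => ⟨le_rfl, le_rfl⟩⟩, ?_,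
      fun _ _ => le_rfl⟩
    rw [hπ0]; exact ae_zero.le (by simp)
  set G : Set (ι → ℝ) := {x | c ≤ f x ∧ f x ≤ M} with hG
  have mG : MeasurableSet G := (measurableSet_le measurable_const hf).inter (measurableSet_le hf measurable_const)
  set g : (ι → ℝ) → ℝ≥0∞ := G.piecewise f (fun _ => c) with hg
  have hgm : Measurable g := hf.piecewise mG measurable_const
  have hg_of_mem : ∀ x ∈ G, g x = f x := fun x hx => Set.piecewise_eq_of_mem _ _ _ hx
  have hg_of_not_mem : ∀ x ∉ G, g x = c := fun x hx => Set.piecewise_eq_of_notMem _ _ _ hx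
  have hcg : ∀ x, c ≤ g x := fun x => by
    by_cases hx : x ∈ G
    · rw [hg_of_mem x hx]; exact hx.1
    · rw [hg_of_not_mem x hx]
  have hgM : ∀ x, g x ≤ M := fun x => by
    by_cases hx : x ∈ G
    · rw [hg_of_mem x hx]; exact hx.2
    · rw [hg_of_not_mem x hx]; exact hcM
  have hgf : g =ᵐ[π] f := by
    filter_upwards [hbd] with x hx using hg_of_mem x hx
  have hgMTP : ∀ᵐ p ∂π.prod π, g p.1 * g p.2 ≤ g (p.1 ⊓ p.2) * g (p.1 ⊔ p.2) := by
    filter_upwards [hMTP, ae_prod_mem_inf_sup_of_sigmaFinite ρ (G := G) hbd] with p hp hG4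
    rw [hg_of_mem _ hG4.1.1, hg_of_mem _ hG4.1.2, hg_of_mem _ hG4.2.1, hg_of_mem _ hG4.2.2]
    exact hp
  obtain ⟨F, hFm, hFb, hFg, hFmtp⟩ := hasPosBorelMTP2Versions_pi ρ g hgm c M hc hM hcg hgM hgMTP
  exact ⟨F, hFm, hFb, hFg.trans hgf, hFmtp⟩

end SigmaFinite

/-! ### The additive form: Borel everywhere-supermodular versions -/

section Additive

omit [Fintype ι] in
/-- **From two-sided MTP₂ versions to supermodular versions.**  If `μ` (a measure on `ℝ^ι`) has the two-sided
Borel-version property, then every bounded measurable `φ : ℝ^ι → ℝ` which is supermodular on `μ ⊗ μ`-almost every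
pair, `φ(x) + φ(y) ≤ φ(x ∧ y) + φ(x ∨ y)`, has a bounded Borel version `ψ = φ` `μ`-a.e. supermodular at EVERY pair
(`ψ = log F` for a two-sided-bounded everywhere-MTP₂ version `F` of `e^φ`). [this work] -/
theorem HasPosBorelMTP2Versions.exists_supermodular_version {μ : Measure (ι → ℝ)} (hP : HasPosBorelMTP2Versions μ)
    (φ : (ι → ℝ) → ℝ) (hφ : Measurable φ) {K : ℝ} (hK : ∀ x, |φ x| ≤ K)
    (hsm : ∀ᵐ p ∂μ.prod μ, φ p.1 + φ p.2 ≤ φ (p.1 ⊓ p.2) + φ (p.1 ⊔ p.2)) :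
    ∃ ψ : (ι → ℝ) → ℝ, Measurable ψ ∧ (∃ K' : ℝ, ∀ x, |ψ x| ≤ K') ∧ ψ =ᵐ[μ] φ ∧
      ∀ x y, ψ x + ψ y ≤ ψ (x ⊓ y) + ψ (x ⊔ y) := by
  set f : (ι → ℝ) → ℝ≥0∞ := fun x => ENNReal.ofReal (Real.exp (φ x)) with hfdef
  have hfm : Measurable f := ENNReal.measurable_ofReal.comp (Real.measurable_exp.comp hφ)
  have hc : ENNReal.ofReal (Real.exp (-K)) ≠ 0 := (ENNReal.ofReal_pos.2 (Real.exp_pos _)).ne'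
  have hcf : ∀ x, ENNReal.ofReal (Real.exp (-K)) ≤ f x := fun x =>
    ENNReal.ofReal_le_ofReal (Real.exp_le_exp.2 (abs_le.1 (hK x)).1)
  have hfM : ∀ x, f x ≤ ENNReal.ofReal (Real.exp K) := fun x =>
    ENNReal.ofReal_le_ofReal (Real.exp_le_exp.2 (abs_le.1 (hK x)).2)
  have hMTP : ∀ᵐ p ∂μ.prod μ, f p.1 * f p.2 ≤ f (p.1 ⊓ p.2) * f (p.1 ⊔ p.2) := by
    filter_upwards [hsm] with p hp
    simp only [hfdef]
    rw [← ENNReal.ofReal_mul (Real.exp_pos _).le, ← ENNReal.ofReal_mul (Real.exp_pos _).le, ← Real.exp_add,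
      ← Real.exp_add]
    exact ENNReal.ofReal_le_ofReal (Real.exp_le_exp.2 hp)
  obtain ⟨F, hFm, ⟨c', M', hc', hM', hFb⟩, hFf, hFmtp⟩ :=
    hP f hfm _ _ hc ENNReal.ofReal_ne_top hcf hfM hMTP
  have hc'T : c' ≠ ∞ := ne_top_of_le_ne_top hM' ((hFb fun _ => 0).1.trans (hFb fun _ => 0).2)
  have hFT : ∀ x, F x ≠ ∞ := fun x => ne_top_of_le_ne_top hM' (hFb x).2
  have hF0 : ∀ x, F x ≠ 0 := fun x => (lt_of_lt_of_le (pos_iff_ne_zero.2 hc') (hFb x).1).ne'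
  have hFpos : ∀ x, 0 < (F x).toReal := fun x => ENNReal.toReal_pos (hF0 x) (hFT x)
  refine ⟨fun x => Real.log (F x).toReal, Real.measurable_log.comp (ENNReal.measurable_toReal.comp hFm),
    ⟨max |Real.log c'.toReal| |Real.log M'.toReal|, fun x => ?_⟩, ?_, fun x y => ?_⟩
  · have h1 : Real.log c'.toReal ≤ Real.log (F x).toReal :=
      Real.log_le_log (ENNReal.toReal_pos hc' hc'T) (ENNReal.toReal_mono (hFT x) (hFb x).1)
    have h2 : Real.log (F x).toReal ≤ Real.log M'.toReal :=
      Real.log_le_log (hFpos x) (ENNReal.toReal_mono hM' (hFb x).2)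
    have h3 : -(max |Real.log c'.toReal| |Real.log M'.toReal|) ≤ Real.log c'.toReal := by
      have ha := neg_abs_le (Real.log c'.toReal)
      have hb := le_max_left |Real.log c'.toReal| |Real.log M'.toReal|
      linarith
    exact abs_le.2 ⟨h3.trans h1, h2.trans (le_max_of_le_right (le_abs_self _))⟩
  · filter_upwards [hFf] with x hx
    show Real.log (F x).toReal = φ x
    rw [hx, hfdef, ENNReal.toReal_ofReal (Real.exp_pos _).le, Real.log_exp]
  · have h := hFmtp x y
    have hL : (F x * F y).toReal ≤ (F (x ⊓ y) * F (x ⊔ y)).toReal :=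
      ENNReal.toReal_mono (ENNReal.mul_ne_top (hFT _) (hFT _)) h
    rw [ENNReal.toReal_mul, ENNReal.toReal_mul] at hL
    rw [← Real.log_mul (hFpos x).ne' (hFpos y).ne', ← Real.log_mul (hFpos _).ne' (hFpos _).ne']
    exact Real.log_le_log (mul_pos (hFpos x) (hFpos y)) hL

/-- **Every finite product of σ-finite measures on `ℝ`: a bounded measurable function which is supermodular on
almost every pair has a bounded Borel version which is supermodular at every pair.**  For `ρᵢ` σ-finite on `ℝ`
(atoms allowed), `|φ| ≤ K` measurable, `φ(x) + φ(y) ≤ φ(x ∧ y) + φ(x ∨ y)` for `(⊗ρᵢ) ⊗ (⊗ρᵢ)`-a.e. `(x, y)` ⟹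
`∃ ψ` Borel, bounded, `ψ = φ` a.e., `ψ(x) + ψ(y) ≤ ψ(x ∧ y) + ψ(x ∨ y)` for ALL `x, y`. [this work] -/
theorem exists_measurable_supermodular_version_of_ae_pi (ρ : ι → Measure ℝ) [∀ i, SigmaFinite (ρ i)]
    (φ : (ι → ℝ) → ℝ) (hφ : Measurable φ) {K : ℝ} (hK : ∀ x, |φ x| ≤ K)
    (hsm : ∀ᵐ p ∂(Measure.pi ρ).prod (Measure.pi ρ), φ p.1 + φ p.2 ≤ φ (p.1 ⊓ p.2) + φ (p.1 ⊔ p.2)) :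
    ∃ ψ : (ι → ℝ) → ℝ, Measurable ψ ∧ (∃ K' : ℝ, ∀ x, |ψ x| ≤ K') ∧ ψ =ᵐ[Measure.pi ρ] φ ∧
      ∀ x y, ψ x + ψ y ≤ ψ (x ⊓ y) + ψ (x ⊔ y) :=
  (hasPosBorelMTP2Versions_pi ρ).exists_supermodular_version φ hφ hK hsm

/-- The same for any s-finite reference measure EQUIVALENT to a finite product of σ-finite measures on `ℝ` (e.g. a
law with an a.e.-positive density with respect to it). [this work] -/
theorem exists_measurable_supermodular_version_of_ae_of_equivalent_pi (ρ : ι → Measure ℝ)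
    [∀ i, SigmaFinite (ρ i)] (μ : Measure (ι → ℝ)) [SFinite μ] (h₁ : μ ≪ Measure.pi ρ) (h₂ : Measure.pi ρ ≪ μ)
    (φ : (ι → ℝ) → ℝ) (hφ : Measurable φ) {K : ℝ} (hK : ∀ x, |φ x| ≤ K)
    (hsm : ∀ᵐ p ∂μ.prod μ, φ p.1 + φ p.2 ≤ φ (p.1 ⊓ p.2) + φ (p.1 ⊔ p.2)) :
    ∃ ψ : (ι → ℝ) → ℝ, Measurable ψ ∧ (∃ K' : ℝ, ∀ x, |ψ x| ≤ K') ∧ ψ =ᵐ[μ] φ ∧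
      ∀ x y, ψ x + ψ y ≤ ψ (x ⊓ y) + ψ (x ⊔ y) :=
  ((hasPosBorelMTP2Versions_pi ρ).of_equivalent h₁ h₂).exists_supermodular_version φ hφ hK hsm

end Additive

end Summit.CriticalPhenomena.PercolationContinuityZ3.Theorems.SahiAEFourFunctions
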